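import Literature.AlgebraicGeometry.ShimuraVarieties.UnitaryShimuraCurveTranslateRigidityPoints
import Literature.AlgebraicGeometry.Morphisms.ClopenPieceOfCoproduct
import Literature.AlgebraicGeometry.Motives.ComplexPointsZariskiDense
import HarnessLib

/-!
# Rigidity of Hecke translates of the unitary Shimura CURVE: a translate trivial along one open immersion is the identity

Topic `AlgebraicGeometry/ShimuraVarieties`; namespace `Literature.AlgebraicGeometry.ShimuraVarieties.UnitaryCanonicalModel`
(home of ★ `RecordSystemGS`, ★ `ShimuraSetGS`).  PROOF FILE (theorems only; no definition, no named fact, no instance, no `sorry`).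

(HEAD) of the (HTR) chain — A-p02 (g14) 2026-08-30 06:09:13Z work order WO-HTR, letter (HTR-rec) verbatim; A-plan2 (g13) 06:10:24Z
three-module mechanics: (R1) ★ `UnitaryShimuraSetGenericStabilizer` (generic stabiliser by counting) ← (R2) ★
`UnitaryShimuraCurveTranslateRigidityPoints` (points form: `T_k` fixing `[v, bN]`, `v` in an open set ⇒ `T_k = 𝟙`) ← THIS FILE, steps
(a)(b)(c) of the letter: for the record system ★ `RecordSystemGS` of the canonical model of `Sh(U(J⋆), 𝔻)` and a Hecke translate
`T_k : M_N ⟶ M_N` (★ `RecordSystemGS.IsHeckeTranslate N N k T_k`), if `(T_k)_τ` is the identity along ONE open immersion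
`e : E ⟶ (M_N)_τ` with `E ≠ ∅` then `T_k = 𝟙 (M_N)`:

* **`RecordSystemGS.heckeTranslate_eq_id_of_comp_eq (S) (hT) (e) (he : e ≫ (T_k)_τ = e) : T_k = 𝟙`.**

Proof: (a) complex points are Zariski-dense in `(M_N)_τ` (★ `dense_image_pt_of_dense`), so one lies in `e(E)`; it sits on a piece
`ι_q : X_q ⟶ (M_N)_τ` of the record's cofan (★ `RecordSystemGS.pieces`, ★ `Morphisms.exists_eq_of_isColimit_cofan`,
★ `Morphisms.isOpenImmersion_of_isColimit_cofan`) and lifts to `X_q(ℂ)` (★ `AlgPoints.range_map_of_isOpenImmersion_holds`), so it is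
`ι_q (unif v₀)` (`surjOn_unif`); (b) `W := 𝔻⁻ ∩ unif⁻¹(ι_q⁻¹ e(E)) ∋ v₀` is open (`continuousOn_unif`, ★ `isOpen_negCone`,
★ `AlgPoints.isOpen_setOf_pt_mem`, ★ `AlgPoints.continuous_map`); (c) for `v ∈ W`, `ι_q (unif v) = (pts⁻¹ [v, g_q N])_τ` (pieces
clause 3) lifts along `e` and is therefore fixed by `(T_k)_τ`; conclude by ONE call of (R2″)
★ `RecordSystemGS.heckeTranslate_eq_id_of_forall_map_baseChange_eq`.
[Milne2005ShimuraVarieties] §5 p. 57 L7–12 («`[x, a] = [γx, γak]`», Lemma 5.13), Thm. 13.6 and §13 p. 118 L21–26;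
[Deligne1979ShimuraVarieties] 2.1.2; [GortzWedhorn2020] §(3.5) Prop. 3.10 / Example 3.11, Prop. 3.35.

USE (d6 `stub_RosH` glue, (G4Σ) weight closure; cure of the piece-multiplicity obstruction A-p18 (g12) 06:00:18Z): the consumer letter
(PF) `∀ δ E [Nonempty] (e) [IsOpenImmersion], e ≫ (act δ)_ℂ = e → act δ = 1` at the GS tower follows from this head for translate
actions (`act δ = T_k`, ★ `sec42HeckeTranslatesGS_tr`, ★ `isHeckeTranslate_recordHeckeTranslateGS`) and injective `act`
(★ `Sec42Data.HeckeTranslates.eq_one_of_translate_rigid`, ★ `exists_pushPull_package_inj`).  Cell `hodgecm-mathlib` (D-0151), crux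
`HLiu418` = stmt-HodgeConjecture-24832.  COUNT-NEUTRAL: HC_CM is proved only modulo the 7 printed citations until rung 0 closes; this file
discharges none of them.

## References
* [Milne2005ShimuraVarieties] J. S. Milne, *Introduction to Shimura varieties* (2005/2017): §5 p. 57 L7–12 and Lemma 5.13; Thm. 13.6 p. 118;
  §13 p. 118 L21–26.
* [Deligne1979ShimuraVarieties] P. Deligne, *Variétés de Shimura* (1979): 2.1.2–2.1.4.
* [GortzWedhorn2020] U. Görtz, T. Wedhorn, *Algebraic Geometry I* (2nd ed. 2020): §(3.5) Prop. 3.10, Example 3.11 (p. 73); Prop. 3.35.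
-/

set_option autoImplicit false

noncomputable section

open Function MulAction Topology NumberField CategoryTheory Matrix AlgebraicGeometry
open scoped Matrix ComplexOrder
open Literature.AlgebraicGeometry.Motives
open Literature.NumberTheory.Automorphic Literature.NumberTheory.Automorphic.UnitaryGroup
open Literature.NumberTheory.Automorphic.Liu2021.AppendixC (C5.OpenCompactSubgroup C5.SmallLevel)

namespace Literature.AlgebraicGeometry.ShimuraVarieties.UnitaryCanonicalModel

section HTRHead

variable {L : Type} [Field L] [NumberField L] [IsCMField L] {Jstar : Matrix (Fin 2) (Fin 2) L} {τ : L →+* ℂ}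
  {K₀ : C5.OpenCompactSubgroup ↥(finAdelic (↥(maximalRealSubfield L)) L (IsCMField.complexConj L) 2 Jstar)}

/-- **(HTR-rec) RIGIDITY OF HECKE TRANSLATES OF THE UNITARY SHIMURA CURVE — open-immersion form.**  For the record system
★ `RecordSystemGS` of the canonical model of `Sh(U(J⋆), 𝔻)` and a Hecke translate `T_k : M_N ⟶ M_N` (★ `RecordSystemGS.IsHeckeTranslate
N N k T_k`): if `(T_k)_τ = T_k ⊗_{L,τ} ℂ` is the identity along ONE open immersion `e : E ⟶ (M_N)_τ` with `E` non-empty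
(`e ≫ (T_k)_τ = e` — e.g. `T_k` trivial on one complex PIECE of `(M_N)_τ`), then `T_k = 𝟙`.  Proof ([Milne2005ShimuraVarieties] §5
p. 57 L7–12, §13 p. 118 L21–26; [Deligne1979ShimuraVarieties] 2.1.2): (a) the complex points of `(M_N)_τ` are Zariski-dense
(★ `dense_image_pt_of_dense`), so one of them, `P`, lies in `e(E)`; by the pieces clause of the record (★ `RecordSystemGS.pieces`: a
cofan colimit of ball quotients `X_q`, uniformised by `v ↦ [v, g_q N]`) `P` lies on some piece `ι_q : X_q ⟶ (M_N)_τ`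
(★ `exists_eq_of_isColimit_cofan`) and lifts to `X_q(ℂ)` (★ `AlgPoints.range_map_of_isOpenImmersion_holds`), hence `P = ι_q(unif v₀)`
(`surjOn_unif`); (b) `W := 𝔻⁻ ∩ unif⁻¹ (ι_q⁻¹ e(E))` is OPEN (`continuousOn_unif`, ★ `isOpen_negCone`, ★ `AlgPoints.isOpen_setOf_pt_mem`)
and non-empty (`v₀ ∈ W`); (c) for `v ∈ W` the point `ι_q(unif v) = (pts⁻¹[v, g_q N])_τ` (pieces clause 3) lifts along `e`, so it is
FIXED by `(T_k)_τ` (`he`); (d)+(e) = ONE call of ★ `RecordSystemGS.heckeTranslate_eq_id_of_forall_map_baseChange_eq` ((R2″): generic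
stabiliser ⇒ `k ∈ z·N`, `z` rational central ⇒ `T_k = T_z = 𝟙`).  Cure of the (G4Σ) piece-multiplicity obstruction of the d6 `stub_RosH`
glue: translate legs have UNIFORM piece kernels.  [cite: Milne2005ShimuraVarieties, §5 p. 57 L7–12 and Lemma 5.13; Thm. 13.6 p. 118, §13 p. 118 L21–26]
[cite: Deligne1979ShimuraVarieties, 2.1.2] [cite: GortzWedhorn2020, §(3.5) Prop. 3.10, Example 3.11 (p. 73); Prop. 3.35] -/
theorem RecordSystemGS.heckeTranslate_eq_id_of_comp_eq (S : RecordSystemGS L Jstar τ K₀) {N : C5.SmallLevel K₀}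
    {k : ↥(finAdelic (↥(maximalRealSubfield L)) L (IsCMField.complexConj L) 2 Jstar)} {Tk : S.M.obj N ⟶ S.M.obj N}
    (hT : S.IsHeckeTranslate N N k Tk) {E : SchemeOver ℂ} [Nonempty ↥E.left]
    (e : E ⟶ (baseChangeHom τ).obj (S.M.obj N)) [IsOpenImmersion e.left]
    (he : e ≫ (baseChangeHom τ).map Tk = e) : Tk = 𝟙 (S.M.obj N) := by
  letI : Algebra L ℂ := τ.toAlgebra
  obtain ⟨g, -, X, ι, hc, B, hB⟩ := S.pieces N
  -- (a) a complex point of `(M_N)_τ` inside `e(E)` (complex points are Zariski-dense), on some piece `X_q`, `= ι_q (unif v₀)`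
  have hUo : IsOpen (Set.range e.left.base) := e.left.isOpenEmbedding.isOpen_range
  haveI := (S.projective N).isProper
  haveI : LocallyOfFiniteType ((baseChangeHom τ).obj (S.M.obj N)).hom := by
    rw [baseChangeHom_obj_hom]
    exact MorphismProperty.pullback_snd _ _ inferInstance
  obtain ⟨x₀⟩ := ‹Nonempty ↥E.left›
  obtain ⟨_, hPU, P, -, rfl⟩ := (dense_image_pt_of_dense (X := (baseChangeHom τ).obj (S.M.obj N))
    (S := Set.univ) dense_univ).inter_open_nonempty _ hUo ⟨e.left.base x₀, x₀, rfl⟩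
  obtain ⟨hc'⟩ := Morphisms.isColimit_cofan_left hc
  obtain ⟨q, z, hz⟩ := Morphisms.exists_eq_of_isColimit_cofan hc' P.pt
  haveI : IsOpenImmersion (ι q).left := Morphisms.isOpenImmersion_of_isColimit_cofan hc' q
  obtain ⟨P', hP'⟩ : P ∈ Set.range (AlgPoints.map (ι q) : ComplexPoints (X q) → _) := by
    rw [AlgPoints.range_map_of_isOpenImmersion_holds]
    exact ⟨z, hz⟩
  have hH : (B q).H.map (B q).E.subtype = Jstar.map τ := (hB q).1
  obtain ⟨v₀, hv₀, hPv₀⟩ := (B q).surjOn_unif (Set.mem_univ P')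
  rw [hH] at hv₀
  -- (b) the open non-empty `W := 𝔻⁻ ∩ unif⁻¹ (ι_q⁻¹ e(E))`
  set V : Set (ComplexPoints (X q)) := {Q | (AlgPoints.map (ι q) Q).pt ∈ e.left.opensRange} with hV
  have hVo : IsOpen V :=
    (AlgPoints.isOpen_setOf_pt_mem (X := (baseChangeHom τ).obj (S.M.obj N)) (L := ℂ) e.left.opensRange).preimage
      (AlgPoints.continuous_map (ι q))
  have hcont : ContinuousOn (B q).unif (negCone (Jstar.map τ)) := by
    have h := (B q).continuousOn_unif
    rwa [hH] at h
  have hWo : IsOpen (negCone (Jstar.map τ) ∩ (B q).unif ⁻¹' V) := hcont.isOpen_inter_preimage (isOpen_negCone _) hVo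
  have hW : negCone (Jstar.map τ) ∩ (B q).unif ⁻¹' V ⊆ negCone (Jstar.map τ) := Set.inter_subset_left
  have hv₀W : v₀ ∈ negCone (Jstar.map τ) ∩ (B q).unif ⁻¹' V := by
    refine ⟨hv₀, ?_⟩
    show (AlgPoints.map (ι q) ((B q).unif v₀)).pt ∈ e.left.opensRange
    rw [hPv₀, hP']
    exact hPU
  -- (c) the points `ι_q (unif v) = (pts⁻¹[v, g_q N])_τ`, `v ∈ W`, lift along `e`, hence are fixed by `(T_k)_τ`; (d)+(e) = (R2″)
  refine S.heckeTranslate_eq_id_of_forall_map_baseChange_eq hT (g q) _ hWo ⟨v₀, hv₀W⟩ hW fun v hv => ?_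
  rw [← (hB q).2.2 v (hW hv)]
  obtain ⟨R, hR⟩ : AlgPoints.map (ι q) ((B q).unif v) ∈ Set.range (AlgPoints.map e : ComplexPoints E → _) := by
    rw [AlgPoints.range_map_of_isOpenImmersion_holds]
    exact hv.2
  rw [← hR, ← AlgPoints.map_comp_apply, he]

end HTRHead

end Literature.AlgebraicGeometry.ShimuraVarieties.UnitaryCanonicalModel

end
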